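import Summits.BirchSwinnertonDyer.BirchSwinnertonDyer.Theorems.CyclotomicUntwistGammaConvolution
import HarnessLib

/-!
# Order of vanishing and leading coefficient at `𝟙` under scalars and units of `Λ_𝓞`, and the SHIFT
# lemma: a typed IMC₃ (`PSFiniteSlopeSelmerData.IsNormalisedFor` / `IsUnitMultipleOf`) transfers the
# order and the leading term at the trivial character (route `CyclotomicUntwist`, crux K1)

Cell `pub/bsd-wall` (D-0145 line `route-BirchSwinnertonDyer-CyclotomicUntwist`), seat `bsd-line-cycu-p1`
(prover seat 1/3), helper toward crux K1 `PSRankOneLowerHalfAtThree` (stmt-BirchSwinnertonDyer-21580).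
THEOREMS ONLY (no definition, no named fact, no `sorry`). BSD is not proved by this file and no crux
of the route is proved by it; IMC₃ is a HYPOTHESIS shape of D3 and stays one.

CONTENT (general `p` in §4–§5, `p = 3` in §6):
* §4 `gammaAmiceTransform_smul`, `gammaMahlerCoeff_smul` — linearity in the ball values (order `< 1`);
* §5 `isUnit_gammaAmiceTransform_of_isIwasawaUnit` (a unit `v ∈ Λ_𝓞^×` has invertible Amice transform:
  constant term `v(Γ)` of norm `1`), `gammaOrderAtOne_gammaConv_of_isIwasawaUnit`
  (`ord_𝟙(v ⋆ μ) = ord_𝟙(μ)`), `gammaLeadingCoeff_gammaConv_of_isIwasawaUnit`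
  (`lead_𝟙(v ⋆ μ) = v(Γ) · lead_𝟙(μ)`), and the scalar versions `gammaOrderAtOne_smul`,
  `gammaLeadingCoeff_smul`;
* §6 for a datum `D : PSFiniteSlopeSelmerData W η α` and ball values `𝓛` that are additive of order `≤ ½`
  (which `IsPSCyclotomicLFunctionOf W η α 𝓛` provides, D1):
  `orderAtOne_eq_of_isNormalisedFor` (`D.orderAtOne = gammaOrderAtOne 3 𝓛`),
  `exists_leadingCoeffAtOne_eq_of_isNormalisedFor` (`D.leadingCoeffAtOne = 3^e · v(Γ) · lead_𝟙(𝓛)`,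
  `e = D.pPowerShift`, `‖v(Γ)‖ = 1`), `norm_leadingCoeffAtOne_of_isNormalisedFor`
  (**SHIFT: `‖D.leadingCoeffAtOne‖ = 3^{-e} · ‖lead_𝟙(𝓛)‖`**), the `IsUnitMultipleOf` version with an
  existential exponent, and `mahlerCoeff_shape_of_isNormalisedFor_of_hasExactOrderAtOne_one`
  (IMC₃ + exact order `= selmerRank = 1` ⇒ `𝓛(𝟙) = c₀ = 0`, `𝓛′(𝟙) = c₁ ≠ 0`, `lead_𝟙(𝓛) = c₁`) — the
  three value-level facts the rank-one reading GZ₃ ∧ IMC₃ ∧ READ of K1 consumes, now DERIVED from the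
  typed IMC₃ instead of being separate hypotheses.

Mathematics: Benois 2014 §0.4 (Main Conjecture (ii), Remark 1: the generator is determined up to
`𝓗^× = Λ[1/p]^× = p^ℤ·Λ^×`), Perrin-Riou 1993 (leading terms), Mazur–Tate–Teitelbaum §I.13, Bellaïche §6.3.5.

References: [cite: Benois2014, §0.4 (ii) and Remark 1; §4.2 Prop. 12] · [cite: PerrinRiou1993AIF, Introduction]
· [cite: MazurTateTeitelbaum1986Invent, §I.13] · [cite: Bellaiche2021, §6.3.5].
-/

noncomputable section

open Filter Topology Finset
open Literature.NumberTheory.EllipticCurves Literature.NumberTheory.IwasawaTheory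
open Summit.BirchSwinnertonDyer.BirchSwinnertonDyer.Theorems.PSGammaConvolution

-- single-conjunct summit: `Summit.BirchSwinnertonDyer.BirchSwinnertonDyer.…` repeats the name by design
set_option linter.dupNamespace false

namespace Summit.BirchSwinnertonDyer.BirchSwinnertonDyer.Theorems.PSGammaLeadingTerm

variable {p : ℕ} [Fact p.Prime]

/-! ### §4 Scalars -/

/-- Riemann sums are linear in the ball values: `RS_n(c·μ) = c · RS_n(μ)`. [cite: MazurTateTeitelbaum1986Invent, §I.13] -/
theorem gammaRiemannSum_smul (c : ℂ_[p]) (μ : (n : ℕ) → ZMod (p ^ n) → ℂ_[p]) (φ : ℕ → ℂ_[p]) (n : ℕ) :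
    gammaRiemannSum p (fun n s ↦ c * μ n s) φ n = c * gammaRiemannSum p μ φ n := by
  simp only [gammaRiemannSum_def, Finset.mul_sum]
  exact Finset.sum_congr rfl fun s _ ↦ by ring

/-- Mahler coefficients are linear in the ball values (order `< 1`): `c_k(c·μ) = c · c_k(μ)`.
[cite: MazurTateTeitelbaum1986Invent, §I.13] -/
theorem gammaMahlerCoeff_smul {ν : ℝ} (c : ℂ_[p]) {μ : (n : ℕ) → ZMod (p ^ n) → ℂ_[p]}
    (hμ : IsGammaDistribution p μ) (hμ' : HasGrowthOrder p ν μ) (hν1 : ν < 1) (k : ℕ) :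
    gammaMahlerCoeff p (fun n s ↦ c * μ n s) k = c * gammaMahlerCoeff p μ k := by
  refine tendsto_nhds_unique (tendsto_gammaRiemannSum_gammaMahlerCoeff (hμ.smul c) (hμ'.smul c) hν1 k) ?_
  have h := (tendsto_gammaRiemannSum_gammaMahlerCoeff hμ hμ' hν1 k).const_mul c
  refine h.congr fun n ↦ ?_
  exact (gammaRiemannSum_smul c μ _ n).symm

/-- The Amice transform is linear in the ball values (order `< 1`): `A(c·μ) = C(c) · A(μ)`.
[cite: MazurTateTeitelbaum1986Invent, §I.13] -/
theorem gammaAmiceTransform_smul {ν : ℝ} (c : ℂ_[p]) {μ : (n : ℕ) → ZMod (p ^ n) → ℂ_[p]}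
    (hμ : IsGammaDistribution p μ) (hμ' : HasGrowthOrder p ν μ) (hν1 : ν < 1) :
    gammaAmiceTransform p (fun n s ↦ c * μ n s) = PowerSeries.C c * gammaAmiceTransform p μ := by
  ext k
  rw [coeff_gammaAmiceTransform, PowerSeries.coeff_C_mul, coeff_gammaAmiceTransform,
    gammaMahlerCoeff_smul c hμ hμ' hν1]


/-! ### §5 Order at `𝟙` and leading coefficient: scalars, and convolution with a unit of `Λ_𝓞` -/

/-- The order at `𝟙` is unchanged by a non-zero scalar (order `< 1`). [cite: Benois2014, §0.4 Remark 1] -/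
theorem gammaOrderAtOne_smul {ν : ℝ} {c : ℂ_[p]} (hc : c ≠ 0) {μ : (n : ℕ) → ZMod (p ^ n) → ℂ_[p]}
    (hμ : IsGammaDistribution p μ) (hμ' : HasGrowthOrder p ν μ) (hν1 : ν < 1) :
    gammaOrderAtOne p (fun n s ↦ c * μ n s) = gammaOrderAtOne p μ := by
  rw [gammaOrderAtOne_def, gammaOrderAtOne_def, gammaAmiceTransform_smul c hμ hμ' hν1,
    PowerSeries.order_mul, PowerSeries.order_zero_of_unit, zero_add]
  exact PowerSeries.isUnit_iff_constantCoeff.mpr (by simpa using hc)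

/-- The leading coefficient at `𝟙` is homogeneous: `lead(c·μ) = c · lead(μ)` (order `< 1`).
[cite: Benois2014, §0.4 Remark 1] -/
theorem gammaLeadingCoeff_smul {ν : ℝ} {c : ℂ_[p]} (hc : c ≠ 0) {μ : (n : ℕ) → ZMod (p ^ n) → ℂ_[p]}
    (hμ : IsGammaDistribution p μ) (hμ' : HasGrowthOrder p ν μ) (hν1 : ν < 1) :
    gammaLeadingCoeff p (fun n s ↦ c * μ n s) = c * gammaLeadingCoeff p μ := by
  rw [gammaLeadingCoeff_def, gammaLeadingCoeff_def, gammaOrderAtOne_smul hc hμ hμ' hν1,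
    gammaOrderAtOne_def, gammaAmiceTransform_smul c hμ hμ' hν1, PowerSeries.coeff_C_mul]

/-- A unit `v ∈ Λ_𝓞^×` has total mass `v(Γ) ≠ 0` (indeed of norm `1`). [cite: Bellaiche2021, §6.3.5] -/
theorem apply_zero_ne_zero_of_isIwasawaUnit {v : (n : ℕ) → ZMod (p ^ n) → ℂ_[p]}
    (hv : IsIwasawaUnit p v) : v 0 0 ≠ 0 := by
  rw [← norm_pos_iff, hv.2.2]
  exact one_pos

/-- **The Amice transform of a unit of `Λ_𝓞` is a unit of `ℂ_p⟦T⟧`**: its constant term is the total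
mass `v(Γ)`, of norm `1`. [cite: Bellaiche2021, §6.3.5] -/
theorem isUnit_gammaAmiceTransform_of_isIwasawaUnit {v : (n : ℕ) → ZMod (p ^ n) → ℂ_[p]}
    (hv : IsIwasawaUnit p v) : IsUnit (gammaAmiceTransform p v) := by
  refine PowerSeries.isUnit_iff_constantCoeff.mpr ?_
  rw [← PowerSeries.coeff_zero_eq_constantCoeff_apply, coeff_gammaAmiceTransform,
    gammaMahlerCoeff_zero hv.1]
  exact isUnit_iff_ne_zero.mpr (apply_zero_ne_zero_of_isIwasawaUnit hv)

/-- A unit of `Λ_𝓞` does not vanish at `𝟙`: its order there is `0`. [cite: Bellaiche2021, §6.3.5] -/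
theorem gammaOrderAtOne_of_isIwasawaUnit {v : (n : ℕ) → ZMod (p ^ n) → ℂ_[p]}
    (hv : IsIwasawaUnit p v) : gammaOrderAtOne p v = 0 :=
  gammaOrderAtOne_eq_zero_of_coeff_zero_ne_zero
    (by rw [gammaMahlerCoeff_zero hv.1]; exact apply_zero_ne_zero_of_isIwasawaUnit hv)

/-- **Convolution with a unit preserves the order at `𝟙`**: `ord_{𝟙}(v ⋆ μ) = ord_{𝟙}(μ)` for
`v ∈ Λ_𝓞^×` and `μ` additive of order `ν ∈ [0, 1)`. [cite: Benois2014, §0.4 Remark 1] [cite: Bellaiche2021, §6.3.5] -/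
theorem gammaOrderAtOne_gammaConv_of_isIwasawaUnit {ν : ℝ} {v μ : (n : ℕ) → ZMod (p ^ n) → ℂ_[p]}
    (hv : IsIwasawaUnit p v) (hμ : IsGammaDistribution p μ) (hμ' : HasGrowthOrder p ν μ)
    (hν : 0 ≤ ν) (hν1 : ν < 1) :
    gammaOrderAtOne p (gammaConv p v μ) = gammaOrderAtOne p μ := by
  rw [gammaOrderAtOne_def, gammaOrderAtOne_def,
    gammaAmiceTransform_gammaConv hv.1 hμ hv.2.1.hasGrowthOrder_zero hμ' le_rfl hν (by simpa using hν1),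
    PowerSeries.order_mul, PowerSeries.order_zero_of_unit (isUnit_gammaAmiceTransform_of_isIwasawaUnit hv),
    zero_add]

/-- **Convolution with a unit multiplies the leading coefficient at `𝟙` by the total mass**:
`lead(v ⋆ μ) = v(Γ) · lead(μ)`, `‖v(Γ)‖ = 1`. [cite: Benois2014, §0.4 Remark 1] [cite: Bellaiche2021, §6.3.5] -/
theorem gammaLeadingCoeff_gammaConv_of_isIwasawaUnit {ν : ℝ} {v μ : (n : ℕ) → ZMod (p ^ n) → ℂ_[p]}
    (hv : IsIwasawaUnit p v) (hμ : IsGammaDistribution p μ) (hμ' : HasGrowthOrder p ν μ)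
    (hν : 0 ≤ ν) (hν1 : ν < 1) :
    gammaLeadingCoeff p (gammaConv p v μ) = v 0 0 * gammaLeadingCoeff p μ := by
  classical
  have hA := gammaAmiceTransform_gammaConv hv.1 hμ hv.2.1.hasGrowthOrder_zero hμ' le_rfl hν
    (by simpa using hν1)
  rw [gammaLeadingCoeff_def, gammaLeadingCoeff_def, gammaOrderAtOne_gammaConv_of_isIwasawaUnit hv hμ hμ' hν hν1,
    gammaOrderAtOne_def, hA, PowerSeries.coeff_mul]
  by_cases h0 : gammaAmiceTransform p μ = 0
  · simp [h0]
  set r := (gammaAmiceTransform p μ).order.toNat with hr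
  have hr' : (r : ℕ∞) = (gammaAmiceTransform p μ).order := PowerSeries.coe_toNat_order h0
  rw [Finset.sum_eq_single (0, r)]
  · rw [PowerSeries.coeff_zero_eq_constantCoeff_apply, ← PowerSeries.coeff_zero_eq_constantCoeff_apply,
      coeff_gammaAmiceTransform, gammaMahlerCoeff_zero hv.1]
  · rintro ⟨i, j⟩ hij hne
    rw [Finset.mem_antidiagonal] at hij
    have hj : j < r := by
      rcases Nat.lt_or_ge j r with h | h
      · exact h
      · exfalso
        have : i = 0 := by omega
        subst this
        simp only [zero_add] at hij
        exact hne (by rw [hij])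
    rw [PowerSeries.coeff_of_lt_order j (by rw [← hr']; exact_mod_cast hj), mul_zero]
  · intro h
    exact absurd (Finset.mem_antidiagonal.mpr (by simp)) h

/-! ### §6 The SHIFT lemma: a typed IMC₃ transfers order and leading term at `𝟙` (p = 3, D3) -/

section Three

open PSFiniteSlopeSelmerData

variable {W : WeierstrassCurve ℚ} {η : DirichletCharacter ℂ_[3] (3 ^ 2)} {α : ℂ_[3]}
  (D : PSFiniteSlopeSelmerData W η α) {𝓛 : (n : ℕ) → ZMod (3 ^ n) → ℂ_[3]}

/-- **IMC₃ (normalised shape) ⇒ equal orders of vanishing at `𝟙`**: if `char = 3^e · (v ⋆ 𝓛)` with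
`v ∈ Λ_𝓞^×` (`D.IsNormalisedFor 𝓛`) and `𝓛` is additive of order `≤ ½` (D1), then
`ord_𝟙(char) = ord_𝟙(𝓛)`. [cite: Benois2014, §0.4 (ii) and Remark 1] -/
theorem orderAtOne_eq_of_isNormalisedFor (h : D.IsNormalisedFor 𝓛) (h𝓛 : IsGammaDistribution 3 𝓛)
    (h𝓛' : HasGrowthOrder 3 (1 / 2) 𝓛) : D.orderAtOne = gammaOrderAtOne 3 𝓛 := by
  obtain ⟨v, hv, hchar⟩ := h
  have hw : IsGammaDistribution 3 (gammaConv 3 v 𝓛) := isGammaDistribution_gammaConv hv.1 h𝓛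
  have hw' : HasGrowthOrder 3 (0 + 1 / 2) (gammaConv 3 v 𝓛) :=
    hasGrowthOrder_gammaConv hv.2.1.hasGrowthOrder_zero h𝓛'
  have hD : D.charElt = fun n s ↦ (3 : ℂ_[3]) ^ D.pPowerShift * gammaConv 3 v 𝓛 n s :=
    funext fun n ↦ funext fun s ↦ hchar n s
  rw [PSFiniteSlopeSelmerData.orderAtOne, hD,
    gammaOrderAtOne_smul (zpow_ne_zero _ (by norm_num)) hw hw' (by norm_num),
    gammaOrderAtOne_gammaConv_of_isIwasawaUnit hv h𝓛 h𝓛' (by norm_num) (by norm_num)]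

/-- **IMC₃ (normalised shape) ⇒ the leading term transfers with the declared shift**:
`lead_𝟙(char) = 3^e · v(Γ) · lead_𝟙(𝓛)` for the unit `v` of the normalisation (`‖v(Γ)‖ = 1`).
[cite: Benois2014, §0.4 (ii) and Remark 1] [cite: PerrinRiou1993AIF, Introduction] -/
theorem exists_leadingCoeffAtOne_eq_of_isNormalisedFor (h : D.IsNormalisedFor 𝓛)
    (h𝓛 : IsGammaDistribution 3 𝓛) (h𝓛' : HasGrowthOrder 3 (1 / 2) 𝓛) :
    ∃ v : (n : ℕ) → ZMod (3 ^ n) → ℂ_[3], IsIwasawaUnit 3 v ∧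
      D.leadingCoeffAtOne = (3 : ℂ_[3]) ^ D.pPowerShift * v 0 0 * gammaLeadingCoeff 3 𝓛 := by
  obtain ⟨v, hv, hchar⟩ := h
  have hw : IsGammaDistribution 3 (gammaConv 3 v 𝓛) := isGammaDistribution_gammaConv hv.1 h𝓛
  have hw' : HasGrowthOrder 3 (0 + 1 / 2) (gammaConv 3 v 𝓛) :=
    hasGrowthOrder_gammaConv hv.2.1.hasGrowthOrder_zero h𝓛'
  have hD : D.charElt = fun n s ↦ (3 : ℂ_[3]) ^ D.pPowerShift * gammaConv 3 v 𝓛 n s :=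
    funext fun n ↦ funext fun s ↦ hchar n s
  refine ⟨v, hv, ?_⟩
  rw [PSFiniteSlopeSelmerData.leadingCoeffAtOne, hD,
    gammaLeadingCoeff_smul (zpow_ne_zero _ (by norm_num)) hw hw' (by norm_num),
    gammaLeadingCoeff_gammaConv_of_isIwasawaUnit hv h𝓛 h𝓛' (by norm_num) (by norm_num), mul_assoc]

/-- **The SHIFT lemma in valuations**: under `D.IsNormalisedFor 𝓛`,
`‖lead_𝟙(char)‖ = 3^{-e} · ‖lead_𝟙(𝓛)‖` — the declared `3`-power exponent `e = pPowerShift` is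
exactly the discrepancy between the algebraic and the analytic leading terms at `𝟙`.
[cite: Benois2014, §0.4 Remark 1] [cite: PerrinRiou1993AIF, Introduction] -/
theorem norm_leadingCoeffAtOne_of_isNormalisedFor (h : D.IsNormalisedFor 𝓛)
    (h𝓛 : IsGammaDistribution 3 𝓛) (h𝓛' : HasGrowthOrder 3 (1 / 2) 𝓛) :
    ‖D.leadingCoeffAtOne‖ = (3 : ℝ) ^ (-D.pPowerShift) * ‖gammaLeadingCoeff 3 𝓛‖ := by
  obtain ⟨v, hv, hlead⟩ := exists_leadingCoeffAtOne_eq_of_isNormalisedFor D h h𝓛 h𝓛'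
  have h3 : ‖(3 : ℂ_[3])‖ = (3 : ℝ)⁻¹ := by
    -- `‖p‖ = p⁻¹` in `ℂ_p` (tree: `Literature.NumberTheory.LFunctions.Dwork.norm_natCast_p_padicComplex`)
    have : ‖((3 : ℕ) : ℂ_[3])‖ = ((3 : ℕ) : ℝ)⁻¹ := by
      rw [← map_natCast (algebraMap ℚ_[3] ℂ_[3]) 3, norm_algebraMap', Padic.norm_p]
    simpa using this
  rw [hlead, norm_mul, norm_mul, hv.2.2, mul_one, norm_zpow, h3, inv_zpow']

/-- **IMC₃ (ideal-identity shape `IsUnitMultipleOf`) ⇒ equal orders at `𝟙` and a `3`-power shift of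
the leading term**: `ord_𝟙(char) = ord_𝟙(𝓛)` and `‖lead_𝟙(char)‖ = 3^{-e} ‖lead_𝟙(𝓛)‖` for SOME
`e ∈ ℤ` (the `𝓗^× = 3^ℤ·Λ^×` ambiguity, invisible in this shape). [cite: Benois2014, §0.4 (ii) and Remark 1] -/
theorem orderAtOne_eq_and_exists_norm_leadingCoeffAtOne_eq_of_isUnitMultipleOf
    (h : D.IsUnitMultipleOf 𝓛) (h𝓛 : IsGammaDistribution 3 𝓛) (h𝓛' : HasGrowthOrder 3 (1 / 2) 𝓛) :
    D.orderAtOne = gammaOrderAtOne 3 𝓛 ∧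
      ∃ e : ℤ, ‖D.leadingCoeffAtOne‖ = (3 : ℝ) ^ (-e) * ‖gammaLeadingCoeff 3 𝓛‖ := by
  obtain ⟨u, ⟨e, v, hv, huv⟩, hchar⟩ := h
  -- the datum with the SAME generator but declared shift `e` is normalised for `𝓛`
  let D' : PSFiniteSlopeSelmerData W η α :=
    { charElt := D.charElt
      isGammaDistribution_charElt := D.isGammaDistribution_charElt
      hasGrowthOrder_charElt := D.hasGrowthOrder_charElt
      pPowerShift := e
      selmerRank := D.selmerRank }
  have hu : u = fun n s ↦ (3 : ℂ_[3]) ^ e * v n s := funext fun n ↦ funext fun s ↦ huv n s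
  have hD' : D'.IsNormalisedFor 𝓛 := by
    refine ⟨v, hv, fun n s ↦ ?_⟩
    show D.charElt n s = (3 : ℂ_[3]) ^ e * gammaConv 3 v 𝓛 n s
    rw [hchar, hu, gammaConv_smul_left]
  exact ⟨orderAtOne_eq_of_isNormalisedFor D' hD' h𝓛 h𝓛',
    e, norm_leadingCoeffAtOne_of_isNormalisedFor D' hD' h𝓛 h𝓛'⟩

/-- **IMC₃ + exact order one ⇒ the analytic rank-one shape of `𝓛` at `𝟙`**: if the characteristic
element is normalised for `𝓛` (D1-additive of order `≤ ½`), vanishes at `𝟙` to order exactly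
`dim H¹(V, D_α)` and that dimension is `1`, then `𝓛(𝟙) = c_0 = 0`, `𝓛′(𝟙) = c_1 ≠ 0`, and `c_1` is
the leading coefficient of `𝓛` at `𝟙` — the three facts the rank-one reading of crux K1 consumes.
[cite: Benois2014, §0.4 (ii), §4.2 Prop. 12] [cite: PerrinRiou1993AIF, Introduction] -/
theorem mahlerCoeff_shape_of_isNormalisedFor_of_hasExactOrderAtOne_one (h : D.IsNormalisedFor 𝓛)
    (h𝓛 : IsGammaDistribution 3 𝓛) (h𝓛' : HasGrowthOrder 3 (1 / 2) 𝓛) (hex : D.HasExactOrderAtOne)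
    (hr : D.selmerRank = 1) :
    gammaMahlerCoeff 3 𝓛 0 = 0 ∧ gammaMahlerCoeff 3 𝓛 1 ≠ 0 ∧
      gammaLeadingCoeff 3 𝓛 = gammaMahlerCoeff 3 𝓛 1 := by
  have hord : gammaOrderAtOne 3 𝓛 = 1 := by
    rw [← orderAtOne_eq_of_isNormalisedFor D h h𝓛 h𝓛', hex, hr, Nat.cast_one]
  rw [gammaOrderAtOne_def] at hord
  have h1 := PowerSeries.order_eq_nat.mp (by exact_mod_cast hord : (gammaAmiceTransform 3 𝓛).order = (1 : ℕ))
  refine ⟨?_, ?_, ?_⟩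
  · have := h1.2 0 zero_lt_one
    rwa [coeff_gammaAmiceTransform] at this
  · have := h1.1
    rwa [coeff_gammaAmiceTransform] at this
  · rw [gammaLeadingCoeff_def, gammaOrderAtOne_def, coeff_gammaAmiceTransform]
    have : ((gammaAmiceTransform 3 𝓛).order).toNat = 1 := by
      rw [show (gammaAmiceTransform 3 𝓛).order = (1 : ℕ) by exact_mod_cast hord]; rfl
    rw [this]

end Three

end Summit.BirchSwinnertonDyer.BirchSwinnertonDyer.Theorems.PSGammaLeadingTerm

end
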